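import Summits.BirchSwinnertonDyer.BirchSwinnertonDyer.Theorems.UniversalToricDescentLocalH1Transfer
import Summits.BirchSwinnertonDyer.BirchSwinnertonDyer.Theorems.UniversalToricDescentInertiaH1Structure
import Summits.BirchSwinnertonDyer.BirchSwinnertonDyer.Theorems.ThetaPartnerAtTwoSignedTransportAtTwoLocalFactorTransport
import HarnessLib

/-!
# Route UniversalToricDescent — Greenberg–Vatsal Prop. (2.4), MODULE form:
# `H¹(K_{∞,w}, A)` is `p`-DIVISIBLE at a place `v ∤ p` finitely decomposed in a `ℤ_p`-extension

Lead prover bsd-wall-utd-p1 g11 (`--supports stmt-BirchSwinnertonDyer-20399`; the item left open in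
memo `GV24-ADDITIVE-LOCAL-TERM-utdp1g10.md` §2b). For a number field `K`, ANY `ℤ_p`-extension `κ`
(`ker κ = Gal(K̄/K_∞)`), a finite place `v ∤ p` NOT split completely in `K_∞`,
`Hi = Gal(K̄_v/K_{∞,w}) = localSubgroup (ker κ) K_v ≤ Γ_{K_v}`, `I = I_{K_v} ≤ Hi`, and a discrete
`p`-primary `p`-DIVISIBLE `Γ_{K_v}`-module `A` with continuous action and finite layers `A[p^k]`
(e.g. `A = E[p^∞]` for an elliptic curve `E/K`, any reduction type at `v`):

* **`exists_nsmul_eq_subgroupH1_localSubgroup` — `H¹(Hi, A) = H¹(K_{∞,w}, A)` is `p`-divisible.**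
  With the landed COUNT `#H¹(K_{∞,w}, E[p^∞])[p] = p^{d_v}` (`UniversalToricDescentLocalTermClosedForm`,
  `…LocalTermGreenbergVatsal`) this is Greenberg–Vatsal's Prop. (2.4) in full:
  `H¹(K_{∞,w}, E[p^∞]) ≅ (ℚ_p/ℤ_p)^{d_v}` (a `p`-divisible `p`-primary group with `p^{d_v}` elements of
  order `p`; the layer counts `#[p^k] = p^{k d_v}` are in the sequel file `…LocalH1DivisibleCurve`).

Chain. `res : H¹(Hi, A) ⥲ H¹(I, A)^{Hi}` is a bijection (`UniversalToricDescentLocalH1Transfer`, `Hi/I`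
pro-prime-to-`p`); `H¹(I, A)` is `p`-divisible (`UniversalToricDescentInertiaH1Structure`, g10, for the
inertia group `I_{K_v}` of the local field, transported here along the tautological isomorphism
`I_{K_v} ≅ I ∩ Hi`); and the new abstract step of §1:

* `exists_pow_nsmul_eq_zero_one` — classes of `H¹(N, M)` (`N` closed in a profinite group, `M` discrete
  `p`-primary) are killed by a power of `p`;
* **`exists_forall_conjMap_eq_and_nsmul_eq`** — AVERAGING over a pro-prime-to-`p` quotient: for a profinite
  `G`, a closed normal `N` with every open normal subgroup of `G/N` of index prime to `p`, and a discrete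
  `p`-primary `G`-module `M`, a `G`-invariant class `y = p·y' ∈ H¹(N, M)` is `p·z` for a `G`-INVARIANT
  class `z` (`z = u · Σ_{g ∈ G/W} g·y'` for an open `W ⊇ N` fixing `y'` — every class has an open
  stabiliser, `exists_isOpen_forall_conjMap_eq` — and `u ≡ [G:W]⁻¹` modulo the order of `y'`); hence
  `(H¹(N, M))^{G}` is `p`-divisible as soon as `H¹(N, M)` is (`…_of_forall_exists`).

THEOREMS ONLY; no definition, no named fact, no `sorry`. BSD is not advanced by this file.
References: [GreenbergVatsal2000] §2, Prop. (2.4) and its proof (arXiv p. 22: "`G_{(K_∞)_η}/I_η` is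
pro-prime-to-`p` … `H¹((K_∞)_η, A) ≅ H¹(I_η, A)^{…}` … divisible"); [GreenbergLNM1716] §3 Lemma 3.3;
[SerreGaloisCohomology1997] I §2.2, I §2.6 (b); [NeukirchSchmidtWingberg2008] (1.6.7).
-/

set_option autoImplicit false
-- `…BirchSwinnertonDyer.BirchSwinnertonDyer.Theorems…` is the problem's mandated namespace (D-0017).
set_option linter.dupNamespace false

noncomputable section

open scoped Classical

namespace Summit.BirchSwinnertonDyer.BirchSwinnertonDyer.Theorems.UniversalToricDescentLocalH1Divisible

open CategoryTheory ContinuousCohomology Function Topology Filter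
open Literature.NumberTheory.GaloisRepresentations

/-! ### §1 Averaging over a pro-prime-to-`p` quotient -/

section General

universe u

variable {G : Type u} [Group G] [TopologicalSpace G] [IsTopologicalGroup G] [CompactSpace G]
  [TotallyDisconnectedSpace G]
variable (N : Subgroup G) [N.Normal] [hN : IsClosed (N : Set G)]
variable {M : Type u} [AddCommGroup M] [TopologicalSpace M] [DiscreteTopology M]
  (ρ : ContinuousRep G ℤ M) {p : ℕ}

omit [TotallyDisconnectedSpace G] [N.Normal] in
/-- **Classes of `H¹(N, M)` are `p`-power torsion** for a closed subgroup `N` of a compact group and a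
discrete `p`-primary `M`: a continuous cocycle has finitely many values, killed by one power of `p`.
[cite: SerreGaloisCohomology1997, I §2.2] -/
theorem exists_pow_nsmul_eq_zero_one (hA : ∀ a : M, ∃ k : ℕ, p ^ k • a = 0)
    (y : continuousCohomology 1 (subgroupRep ρ.toTopRep N)) : ∃ k : ℕ, p ^ k • y = 0 := by
  haveI : CompactSpace N := isCompact_iff_compactSpace.mp hN.isCompact
  obtain ⟨φ, rfl⟩ := oneCocycleClass_surjective _ y
  have hfin : (Set.range φ.1).Finite := (isCompact_range φ.1.continuous).finite_of_discrete
  choose f hf using hA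
  refine ⟨hfin.toFinset.sup f, ?_⟩
  have hk : ∀ x : N, p ^ hfin.toFinset.sup f • φ.1 x = 0 := fun x ↦ by
    have hle : f (φ.1 x) ≤ hfin.toFinset.sup f :=
      Finset.le_sup (hfin.mem_toFinset.mpr ⟨x, rfl⟩)
    rw [← Nat.sub_add_cancel hle, pow_add, mul_smul, hf, smul_zero]
  have hφ : ((p ^ hfin.toFinset.sup f : ℕ) : ℤ) • φ = 0 := Subtype.ext (ContinuousMap.ext fun x ↦ by
    change ((p ^ hfin.toFinset.sup f : ℕ) : ℤ) • φ.1 x = 0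
    rw [Nat.cast_smul_eq_nsmul, hk])
  rw [← Nat.cast_smul_eq_nsmul ℤ, ← oneCocycleClass_smul, hφ, oneCocycleClass_zero]

/-- **Averaging over a pro-prime-to-`p` quotient.** `G` profinite, `N ⊴ G` closed with every open normal
subgroup of `G ⧸ N` of index prime to `p`, `M` a discrete `p`-primary `G`-module. If a class
`y ∈ H¹(N, M)` fixed by the conjugation action of every `g ∈ G` is `p · y'` for SOME class `y'`, then
`y = p · z` for a `G`-INVARIANT class `z`: with `W = V·N` (`V` open normal inside the open stabiliser of
`y'`, `exists_isOpen_forall_conjMap_eq`), `[G : W]` is prime to `p`, the orbit sum `s = Σ_{gW} g·y'` is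
`G`-invariant with `p·s = [G:W]·y`, and `z = u·s` for `u·[G:W] ≡ 1` modulo a power of `p` killing `y'`.
(The step "`H¹((K_∞)_η, A) ≅ H¹(I_η, A)^{G/I_η}` is divisible" of Greenberg–Vatsal.)
[cite: GreenbergVatsal2000, §2, proof of Prop. (2.4) (arXiv p. 22)] -/
theorem exists_forall_conjMap_eq_and_nsmul_eq
    (hcop : ∀ U : Subgroup (G ⧸ N), U.Normal → IsOpen (U : Set (G ⧸ N)) → U.index.Coprime p)
    (hA : ∀ a : M, ∃ k : ℕ, p ^ k • a = 0)
    {y y' : continuousCohomology 1 (subgroupRep ρ.toTopRep N)}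
    (hy : ∀ g : G, conjMap ρ.toTopRep N g 1 y = y) (hyy' : p • y' = y) :
    ∃ z : continuousCohomology 1 (subgroupRep ρ.toTopRep N),
      (∀ g : G, conjMap ρ.toTopRep N g 1 z = z) ∧ p • z = y := by
  -- the stabiliser of `y'`
  let S : Subgroup G :=
    { carrier := {g | conjMap ρ.toTopRep N g 1 y' = y'}
      one_mem' := conjMap_one_one ρ.toTopRep N y'
      mul_mem' := fun {a b} ha hb ↦ by
        change conjMap ρ.toTopRep N (a * b) 1 y' = y'
        rw [← conjMap_conjMap, (hb : conjMap ρ.toTopRep N b 1 y' = y'), ha]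
      inv_mem' := fun {a} ha ↦ by
        change conjMap ρ.toTopRep N a⁻¹ 1 y' = y'
        conv_lhs => rw [← (ha : conjMap ρ.toTopRep N a 1 y' = y')]
        rw [conjMap_conjMap, inv_mul_cancel, conjMap_one_one] }
  -- an open normal subgroup of `G` inside `S`
  obtain ⟨U₀, hU₀o, hU₀⟩ := exists_isOpen_forall_conjMap_eq N ρ y'
  obtain ⟨V, hV⟩ := ProfiniteGrp.exist_openNormalSubgroup_sub_open_nhds_of_one hU₀o U₀.one_mem
  -- `W = V N ≤ S` is open of index prime to `p`
  let W : Subgroup G := (V : Subgroup G) ⊔ N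
  have hWS : W ≤ S := sup_le (fun v hv ↦ hU₀ v (hV hv)) (fun n hn ↦ conjMap_eq_self_of_mem_one ρ.toTopRep N hn y')
  have hWopen : IsOpen (W : Set G) := Subgroup.isOpen_mono le_sup_left V.isOpen
  have hWcop : W.index.Coprime p := by
    have h1 := hcop (((V : Subgroup G)).map (QuotientGroup.mk' N))
      (Subgroup.Normal.map inferInstance _ (QuotientGroup.mk'_surjective N))
      (QuotientGroup.isOpenMap_coe (V : Set G) V.isOpen)
    rwa [Subgroup.index_map, QuotientGroup.ker_mk', MonoidHom.range_eq_top.mpr (QuotientGroup.mk'_surjective N),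
      Subgroup.index_top, mul_one] at h1
  haveI : Finite (G ⧸ W) := Subgroup.quotient_finite_of_isOpen W hWopen
  letI : Fintype (G ⧸ W) := Fintype.ofFinite _
  -- the orbit sum of `y'` over `G/W`
  let F : G ⧸ W → continuousCohomology 1 (subgroupRep ρ.toTopRep N) := fun c ↦
    Quotient.liftOn' c (fun g ↦ conjMap ρ.toTopRep N g 1 y') fun a b hab ↦ by
      rw [QuotientGroup.leftRel_apply] at hab
      change conjMap ρ.toTopRep N a 1 y' = conjMap ρ.toTopRep N b 1 y'
      conv_rhs => rw [show b = a * (a⁻¹ * b) by group, ← conjMap_conjMap, (hWS hab : conjMap ρ.toTopRep N (a⁻¹ * b) 1 y' = y')]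
  have hF : ∀ g : G, F (QuotientGroup.mk g) = conjMap ρ.toTopRep N g 1 y' := fun _ ↦ rfl
  have hFsmul : ∀ (h : G) (c : G ⧸ W), conjMap ρ.toTopRep N h 1 (F c) = F (h • c) := fun h c ↦ by
    induction c using QuotientGroup.induction_on with
    | H g => rw [hF, conjMap_conjMap, MulAction.Quotient.smul_mk, hF, smul_eq_mul]
  have hpF : ∀ c : G ⧸ W, p • F c = y := fun c ↦ by
    induction c using QuotientGroup.induction_on with
    | H g => rw [hF, ← map_nsmul, hyy', hy]
  let s : continuousCohomology 1 (subgroupRep ρ.toTopRep N) := ∑ c : G ⧸ W, F c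
  have hs : ∀ h : G, conjMap ρ.toTopRep N h 1 s = s := fun h ↦ by
    simp only [s, map_sum, hFsmul]
    exact Fintype.sum_equiv (MulAction.toPerm h) _ _ fun _ ↦ rfl
  have hps : p • s = W.index • y := by
    simp only [s, Finset.smul_sum, hpF, Finset.sum_const, Finset.card_univ, Subgroup.index,
      Nat.card_eq_fintype_card]
  -- invert the index modulo the order of `y'`
  obtain ⟨k, hk⟩ := exists_pow_nsmul_eq_zero_one N ρ hA y'
  have hky : p ^ k • y = 0 := by rw [← hyy', smul_comm, hk, smul_zero]
  obtain ⟨u, w, huw⟩ := Nat.isCoprime_iff_coprime.mpr (hWcop.pow_right k)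
  refine ⟨u • s, fun g ↦ by rw [map_zsmul, hs], ?_⟩
  have h1 : u * (W.index : ℤ) = 1 - w * ((p ^ k : ℕ) : ℤ) := eq_sub_of_add_eq huw
  rw [smul_comm, hps, ← natCast_zsmul y W.index, smul_smul, h1, sub_zsmul, one_zsmul, mul_zsmul, natCast_zsmul,
    hky, zsmul_zero, neg_zero, add_zero]

/-- **`H¹(N, M)^{G}` is `p`-divisible when `H¹(N, M)` is** (`G ⧸ N` pro-prime-to-`p`, `M` discrete
`p`-primary): every `G`-invariant class is `p` times a `G`-invariant class.
[cite: GreenbergVatsal2000, §2, proof of Prop. (2.4) (arXiv p. 22)] -/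
theorem exists_forall_conjMap_eq_and_nsmul_eq_of_forall_exists
    (hcop : ∀ U : Subgroup (G ⧸ N), U.Normal → IsOpen (U : Set (G ⧸ N)) → U.index.Coprime p)
    (hA : ∀ a : M, ∃ k : ℕ, p ^ k • a = 0)
    (hdivN : ∀ y : continuousCohomology 1 (subgroupRep ρ.toTopRep N),
      ∃ y' : continuousCohomology 1 (subgroupRep ρ.toTopRep N), p • y' = y)
    (y : continuousCohomology 1 (subgroupRep ρ.toTopRep N)) (hy : ∀ g : G, conjMap ρ.toTopRep N g 1 y = y) :
    ∃ z : continuousCohomology 1 (subgroupRep ρ.toTopRep N),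
      (∀ g : G, conjMap ρ.toTopRep N g 1 z = z) ∧ p • z = y := by
  obtain ⟨y', hyy'⟩ := hdivN y
  exact exists_forall_conjMap_eq_and_nsmul_eq N ρ hcop hA hy hyy'

end General

/-! ### §2 `H¹(K_{∞,w}, A)` is `p`-divisible -/

section Local

open NumberField IsDedekindDomain Field ValuativeRel
open Literature.NumberTheory.EllipticCurves IsDedekindDomain.HeightOneSpectrum
  Literature.NumberTheory.GaloisRepresentations.IsNonarchimedeanLocalField
  Summit.BirchSwinnertonDyer.Rank1Residual.Iwasawa.NonsingularTower
  Summit.BirchSwinnertonDyer.Rank1Residual.Iwasawa.NonsplitTower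
  Summit.BirchSwinnertonDyer.BirchSwinnertonDyer.Theorems.UniversalToricDescentLocalH1Count
  Summit.BirchSwinnertonDyer.BirchSwinnertonDyer.Theorems.UniversalToricDescentLocalH1Transfer
  Summit.BirchSwinnertonDyer.BirchSwinnertonDyer.Theorems.UniversalToricDescentInertiaH1Structure
  Summit.BirchSwinnertonDyer.BirchSwinnertonDyer.Theorems.SignedTransportAtTwo

variable {K : Type} [Field K] [NumberField K] {v : HeightOneSpectrum (𝓞 K)} {p : ℕ} [Fact p.Prime]
  (κ : ZpExtension K p)

/-- **Greenberg–Vatsal Prop. (2.4), module form: `H¹(K_{∞,w}, A)` is `p`-divisible.** For ANY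
`ℤ_p`-extension `κ` of a number field `K`, a finite place `v ∤ p` not split completely in `K_∞` (`hns`),
`Hi = Gal(K̄_v/K_{∞,w}) = localSubgroup (ker κ) K_v`, and a discrete `Γ_{K_v}`-module `A` with continuous
action which is `p`-primary, `p`-DIVISIBLE and has finite layers `A[p^k]` (e.g. `E[p^∞]`, any reduction
type): **every class of `H¹(Hi, A)` is `p` times a class.** Chain: `res : H¹(Hi, A) ⥲ H¹(I ∩ Hi, A)^{Hi}`
(`resSubgroup_localSubgroup_bijective`); `H¹(I_{K_v}, A)` is `p`-divisible
(`exists_nsmul_eq_continuousCohomology_one_absInertia`), transported along `I_{K_v} ≅ I ∩ Hi`; averaging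
over the pro-prime-to-`p` quotient `Hi/I` (§1). Together with `#H¹(K_{∞,w}, E[p^∞])[p] = p^{d_v}`
(`natCard_pTorsion_subgroupH1_kerD_eq_pow_ite`): `H¹(K_{∞,w}, E[p^∞]) ≅ (ℚ_p/ℤ_p)^{d_v}`.
[cite: GreenbergVatsal2000, §2 Prop. (2.4) and proof (arXiv p. 22)] [cite: GreenbergLNM1716, §3 Lemma 3.3] -/
theorem exists_nsmul_eq_subgroupH1_localSubgroup (hpv : (p : 𝓞 K) ∉ v.asIdeal)
    (hns : ∃ σ : absoluteGaloisGroup (v.adicCompletion K),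
      σ ∉ localSubgroup κ.kerSubgroup (v.adicCompletion K))
    {A : Type} [AddCommGroup A] [DistribMulAction (absoluteGaloisGroup (v.adicCompletion K)) A]
    [TopologicalSpace A] [DiscreteTopology A] (hA : ∀ a : A, ∃ k : ℕ, p ^ k • a = 0)
    (hdiv : ∀ a : A, ∃ b : A, p • b = a) (hfin : ∀ k : ℕ, Set.Finite {a : A | p ^ k • a = 0})
    (hcont : ∀ a : A, Continuous fun g : absoluteGaloisGroup (v.adicCompletion K) ↦ g • a)
    (x : Literature.NumberTheory.EllipticCurves.subgroupH1
      (localSubgroup κ.kerSubgroup (v.adicCompletion K)) A) :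
    ∃ x' : Literature.NumberTheory.EllipticCurves.subgroupH1
      (localSubgroup κ.kerSubgroup (v.adicCompletion K)) A, p • x' = x := by
  -- notation
  let Fv := v.adicCompletion K
  let G : Type := absoluteGaloisGroup Fv
  let Hi : Subgroup G := localSubgroup κ.kerSubgroup Fv
  let I : Subgroup G := absInertia Fv
  let N : Subgroup Hi := I.subgroupOf Hi
  haveI : CharZero Fv := charZero_of_injective_algebraMap (algebraMap K Fv).injective
  haveI := absoluteGaloisGroup_compactSpace Fv
  haveI : TotallyDisconnectedSpace G := by
    change TotallyDisconnectedSpace (AlgebraicClosure Fv ≃ₐ[Fv] AlgebraicClosure Fv); infer_instance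
  haveI hIn : (absInertia Fv).Normal := absInertia_normal_holds Fv
  have hℓ : ringChar 𝓀[Fv] ≠ p := v.ringChar_residueField_adicCompletion_ne hpv
  -- topology of `Hi` and `N`
  have hHic : IsClosed (Hi : Set G) :=
    κ.isClosed_kerSubgroup.preimage (map_continuous (resGal (K := K) Fv))
  haveI : CompactSpace Hi := isCompact_iff_compactSpace.mp hHic.isCompact
  have hNc : IsClosed (N : Set Hi) := (isClosed_absInertia_holds Fv).preimage continuous_subtype_val
  haveI : IsClosed (N : Set Hi) := hNc
  -- `A` as a `ContinuousRep`; the definitional bridge to `discreteTopRep`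
  let ρ : ContinuousRep G ℤ A :=
    { toRepresentation := (discreteContRep G A).toRepresentation
      continuous_smul := continuous_prod_of_discrete_right.mpr fun a ↦ hcont a }
  let ρH : ContinuousRep Hi ℤ A :=
    ρ.restrict (Literature.NumberTheory.GaloisRepresentations.subgroupIncl Hi)
  have hbridge : ρH.toTopRep = discreteTopRep Hi A := rfl
  -- the quotient `Hi/N` is pro-prime-to-`p`
  have hcop : ∀ U : Subgroup (Hi ⧸ N), U.Normal → IsOpen (U : Set (Hi ⧸ N)) → U.index.Coprime p :=
    fun U _ hU ↦ coprime_index_of_quotient_localSubgroup_absInertia κ hpv hns U hU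
  -- `H¹(N, A)` is `p`-divisible: g10's theorem for `I_F`, transported along `I ≅ N`
  have hle : I ≤ Hi := absInertia_le_localSubgroup κ hpv
  let θ : I →ₜ* N :=
    { toFun := fun x ↦ ⟨⟨x.1, hle x.2⟩, Subgroup.mem_subgroupOf.mpr x.2⟩
      map_one' := rfl
      map_mul' := fun _ _ ↦ rfl
      continuous_toFun := (continuous_subtype_val.subtype_mk _).subtype_mk _ }
  have hθ : Surjective θ := fun y ↦
    ⟨⟨((y : Hi) : G), Subgroup.mem_subgroupOf.mp y.2⟩, Subtype.ext (Subtype.ext rfl)⟩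
  let sθ : N → I := fun y ↦ ⟨((y : Hi) : G), Subgroup.mem_subgroupOf.mp y.2⟩
  have hsθ : Continuous sθ := (continuous_subtype_val.comp continuous_subtype_val).subtype_mk _
  let X : TopRep ℤ N := subgroupRep (discreteTopRep Hi A) N
  have heq : TopRep.res (θ : I →* N) X =
      (ρ.restrict (Literature.NumberTheory.GaloisRepresentations.subgroupIncl I)).toTopRep := rfl
  have hαinj := map_one_injective_of_surjective X θ hθ
  have hαsurj := map_one_surjective_of_inverse X θ sθ hsθ (fun y ↦ Subtype.ext (Subtype.ext rfl))
    (fun x ↦ Subtype.ext rfl)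
  have hI : ∀ t : continuousCohomology 1 (TopRep.res (θ : I →* N) X),
      ∃ t' : continuousCohomology 1 (TopRep.res (θ : I →* N) X), p • t' = t := by
    rw [heq]
    exact exists_nsmul_eq_continuousCohomology_one_absInertia Fv hℓ ρ hA hdiv hfin
  have hdivN : ∀ y : continuousCohomology 1 X, ∃ y' : continuousCohomology 1 X, p • y' = y := by
    intro y
    obtain ⟨t', ht'⟩ := hI (ContinuousCohomology.map θ (𝟙 (TopRep.res (θ : I →* N) X)) 1 y)
    obtain ⟨y', rfl⟩ := hαsurj t'
    refine ⟨y', hαinj ?_⟩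
    rw [map_nsmul, ht']
  -- the restriction `res : H¹(Hi, A) ⥲ H¹(N, A)^{Hi}` and the averaging step
  have hbij := resSubgroup_localSubgroup_bijective κ hpv hns hA hcont
  have hy : ∀ h : Hi, conjMap ρH.toTopRep N h 1 (resSubgroup ρH.toTopRep N 1 x) = resSubgroup ρH.toTopRep N 1 x :=
    fun h ↦ conjMap_resSubgroup_one _ _ h x
  obtain ⟨z, hz, hpz⟩ := exists_forall_conjMap_eq_and_nsmul_eq_of_forall_exists N ρH hcop hA hdivN
    (resSubgroup ρH.toTopRep N 1 x) hy
  obtain ⟨x', hx'⟩ := hbij.2 ⟨z, hz⟩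
  refine ⟨x', hbij.1 (Subtype.ext ?_)⟩
  have hx'' : resSubgroup ρH.toTopRep N 1 x' = z := congrArg Subtype.val hx'
  have h1 : resSubgroup ρH.toTopRep N 1 (p • x') = p • resSubgroup ρH.toTopRep N 1 x' :=
    map_nsmul _ p x'
  exact h1.trans ((congrArg (fun w ↦ p • w) hx'').trans hpz)

end Local

end Summit.BirchSwinnertonDyer.BirchSwinnertonDyer.Theorems.UniversalToricDescentLocalH1Divisible

end
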